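import Literature.Analysis.FluidPDE.TypeIAncientMildRssPullback
import Mathlib.Analysis.SpecialFunctions.Exponential
import Mathlib.Analysis.SpecialFunctions.Pow.Real
import Mathlib.Analysis.Calculus.MeanValue
import HarnessLib

/-!
# CoriolisHeadTypeIRateTransport — crux `NoCoRotatingCore` (stmt-NavierStokesRegularity-22676), line
# `far_field_constancy` v2 (skeleton 15c9a82ad206abb9), stub K1c `stub_typeIRate` — file 1/2: the SPIRAL TRANSPORT LEMMA

The line card proves K1b/K1c «along the outward spiral characteristics of `V = ay − By`» (`a > 0`, `B` skew,
`|y(s)| ≍ e^{as}`): `dU/ds + (aI + B)U = forcing`.  This file is that mechanism in kernel form, for an arbitrary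
`C¹` field `W : ℝ³ → ℝ³` (no profile system here):

* §1 the flow `γ(s) = exp(s(a·1 − B)) y₀` of the drift (`NormedSpace.exp` in the Banach algebra `ℝ³ →L ℝ³`):
  `γ' = aγ − Bγ` (`hasDerivAt_flow`), **`‖γ(s)‖ = e^{as}‖y₀‖`** for skew `B` (`norm_flow`), the group law, and
  `exists_flow_eq`: every `y` with `‖y‖ ≥ R > 0` is `γ(s)` for some `‖y₀‖ = R`, `s = a⁻¹ log(‖y‖/R) ≥ 0`;
  `exp(sB)` is an isometry commuting with `B` (tree `rss_exists_rot`).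
* §2 **`norm_mul_norm_le_of_transport`**: if `‖W‖ ≤ m` on the sphere `‖y‖ = R` and the TRANSPORT EXPRESSION
  `G = DW·(ay − By) + aW + BW` obeys `‖G(y)‖ ≤ D/‖y‖² + C/‖y‖^{1+δ}` (`δ > 0`) on the shell `R ≤ ‖y‖ ≤ ρ`, then
  `‖y‖‖W(y)‖ ≤ Rm + D/(aR) + C/(aδR^δ)` there.  Proof: the conjugated unknown `Z(s) = e^{as} exp(sB) W(γ(s))` has
  `Z' = e^{as} exp(sB) G(γ(s))`, so `‖Z'‖ = e^{as}‖G(γ(s))‖ ≤ (D/R²)e^{−as} + (C/R^{1+δ})e^{−aδs}`, and Mathlib's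
  fencing lemma `image_norm_le_of_norm_deriv_right_le_deriv_boundary` integrates it; the homogeneous decay
  `e^{−as} = R/‖y‖` IS the Type-I rate, and an `O(1/r)` forcing (`δ = 0`) would integrate to the resonant
  logarithm `(log r)/r` of the line card.

File 2/2 (`CoriolisHeadTypeIRateReduction.lean`) absorbs a linear term with integrable coefficient by a bootstrap,
shifts the centre of the spirals, and REDUCES K1c to a power decay of `∇P − g`.  Everything is proved; no definitions,
no named facts.  WHAT THIS IS NOT: K1c (`stub_typeIRate`), K1a and `NoCoRotatingCore` stay OPEN; nothing here proves
Pineau–Vicol's Conjecture 1.1 or Navier–Stokes regularity.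

References: line card `Cruxes/NoCoRotatingCore/Lines/far_field_constancy.md` (K1b/K1c sketches); B. Pineau, V. Vicol,
arXiv:2607.09619 (2026), (1.7)–(1.9), Prop. 3.1 [PineauVicol2026]; T.-P. Tsai, ARMA 143 (1998) [Tsai1998].
-/

noncomputable section

open Set Function Filter Topology Metric InnerProductSpace Real

-- the summit and its single sub-problem share the name (CONVENTIONS §1), as in every Theorems file
set_option linter.dupNamespace false
-- nested operator types `ℝ³ →L[ℝ] ℝ³` inside the Banach algebra `ℝ³ →L[ℝ] ℝ³` (as in `FluidPDE/NewtonPotential`)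
set_option maxSynthPendingDepth 3

namespace Summit.NavierStokesRegularity.NavierStokesRegularity.Theorems.CoriolisHead

namespace TypeIRate

open Literature.Analysis.FluidPDE
open scoped RealInnerProductSpace

/-! ## §1 The spiral flow `s ↦ exp(s(a − B)) y₀` of the drift `V(y) = ay − By` -/

/-- The flow `γ(s) = exp(sA) y₀` of a bounded operator solves `γ' = Aγ`. [folklore] -/
theorem hasDerivAt_flow (A : EuclideanSpace ℝ (Fin 3) →L[ℝ] EuclideanSpace ℝ (Fin 3))
    (y₀ : EuclideanSpace ℝ (Fin 3)) (s : ℝ) :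
    HasDerivAt (fun s : ℝ => NormedSpace.exp (s • A) y₀) (A (NormedSpace.exp (s • A) y₀)) s := by
  simpa using (hasDerivAt_exp_smul_const' (𝕂 := ℝ) A s).clm_apply (hasDerivAt_const s y₀)

/-- **Radial growth along the spiral flow.**  For `B` skew (`⟪Bx, x⟫ = 0`) the flow of
`V(y) = ay − By` expands norms exactly exponentially: `‖exp(s(a − B)) y₀‖ = e^{as}‖y₀‖`
(`d/ds ‖γ‖² = 2⟪γ, aγ − Bγ⟫ = 2a‖γ‖²`). [folklore] -/
theorem norm_flow {B : EuclideanSpace ℝ (Fin 3) →L[ℝ] EuclideanSpace ℝ (Fin 3)}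
    (hB : ∀ x, inner ℝ (B x) x = 0) (a : ℝ) (y₀ : EuclideanSpace ℝ (Fin 3)) (s : ℝ) :
    ‖NormedSpace.exp (s • (a • (1 : EuclideanSpace ℝ (Fin 3) →L[ℝ] EuclideanSpace ℝ (Fin 3)) - B)) y₀‖ =
      Real.exp (a * s) * ‖y₀‖ := by
  set A : EuclideanSpace ℝ (Fin 3) →L[ℝ] EuclideanSpace ℝ (Fin 3) :=
    a • (1 : EuclideanSpace ℝ (Fin 3) →L[ℝ] EuclideanSpace ℝ (Fin 3)) - B with hA
  set γ : ℝ → EuclideanSpace ℝ (Fin 3) := fun s => NormedSpace.exp (s • A) y₀ with hγ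
  have hγ' : ∀ s, HasDerivAt γ (A (γ s)) s := hasDerivAt_flow A y₀
  have hinner : ∀ s, ⟪γ s, A (γ s)⟫ = a * ‖γ s‖ ^ 2 := fun s => by
    change ⟪γ s, a • γ s - B (γ s)⟫ = a * ‖γ s‖ ^ 2
    rw [inner_sub_right, real_inner_smul_right, real_inner_self_eq_norm_sq, real_inner_comm, hB,
      sub_zero]
  -- `φ(s) = e^{-2as} ‖γ s‖²` is constant
  have hφ : ∀ s, HasDerivAt (fun s => Real.exp (-(2 * a) * s) * ‖γ s‖ ^ 2) 0 s := by
    intro s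
    have h1 : HasDerivAt (fun s => ‖γ s‖ ^ 2) (2 * ⟪γ s, A (γ s)⟫) s := (hγ' s).norm_sq
    have h2 : HasDerivAt (fun s : ℝ => Real.exp (-(2 * a) * s))
        (Real.exp (-(2 * a) * s) * (-(2 * a))) s := by
      have h := ((hasDerivAt_id s).const_mul (-(2 * a))).exp
      simpa using h
    have h3 := h2.mul h1
    refine h3.congr_deriv ?_
    rw [hinner]
    ring
  have hconst := is_const_of_deriv_eq_zero (fun s => (hφ s).differentiableAt)
    (fun s => (hφ s).deriv) s 0
  have h0 : Real.exp (-(2 * a) * 0) * ‖γ 0‖ ^ 2 = ‖y₀‖ ^ 2 := by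
    change Real.exp (-(2 * a) * 0) * ‖NormedSpace.exp ((0 : ℝ) • A) y₀‖ ^ 2 = ‖y₀‖ ^ 2
    rw [zero_smul ℝ A, NormedSpace.exp_zero, mul_zero, Real.exp_zero, one_mul]
    rfl
  rw [h0] at hconst
  -- hconst : exp(-2as) ‖γ s‖² = ‖y₀‖²
  have e1 : Real.exp (-(2 * a) * s) * Real.exp (a * s) ^ 2 = 1 := by
    rw [sq, ← Real.exp_add, ← Real.exp_add, show -(2 * a) * s + (a * s + a * s) = 0 by ring,
      Real.exp_zero]
  have hsq : ‖γ s‖ ^ 2 = (Real.exp (a * s) * ‖y₀‖) ^ 2 := by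
    calc ‖γ s‖ ^ 2 = (Real.exp (-(2 * a) * s) * Real.exp (a * s) ^ 2) * ‖γ s‖ ^ 2 := by
          rw [e1, one_mul]
      _ = Real.exp (a * s) ^ 2 * (Real.exp (-(2 * a) * s) * ‖γ s‖ ^ 2) := by ring
      _ = (Real.exp (a * s) * ‖y₀‖) ^ 2 := by rw [hconst]; ring
  exact (sq_eq_sq₀ (norm_nonneg _) (by positivity)).1 hsq

/-- The group law of the flow: `exp(sA) (exp(−sA) y) = y`. [folklore] -/
theorem flow_flow_neg (A : EuclideanSpace ℝ (Fin 3) →L[ℝ] EuclideanSpace ℝ (Fin 3))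
    (y : EuclideanSpace ℝ (Fin 3)) (s : ℝ) :
    NormedSpace.exp (s • A) (NormedSpace.exp ((-s) • A) y) = y := by
  have h : NormedSpace.exp (s • A) * NormedSpace.exp ((-s) • A) = 1 := by
    rw [← rss_exp_add_smul, add_neg_cancel, zero_smul, NormedSpace.exp_zero]
  show (NormedSpace.exp (s • A) * NormedSpace.exp ((-s) • A)) y = y
  rw [h]
  rfl

/-- **Every far point lies on a characteristic from the sphere of radius `R`**: for `a > 0`, `B` skew,
`0 < R ≤ ‖y‖`, there are `y₀` with `‖y₀‖ = R` and `s ≥ 0` with `e^{as} R = ‖y‖` and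
`exp(s(a − B)) y₀ = y`. [folklore] -/
theorem exists_flow_eq {a : ℝ} (ha : 0 < a)
    {B : EuclideanSpace ℝ (Fin 3) →L[ℝ] EuclideanSpace ℝ (Fin 3)} (hB : ∀ x, inner ℝ (B x) x = 0)
    {R : ℝ} (hR : 0 < R) {y : EuclideanSpace ℝ (Fin 3)} (hy : R ≤ ‖y‖) :
    ∃ (y₀ : EuclideanSpace ℝ (Fin 3)) (s : ℝ), ‖y₀‖ = R ∧ 0 ≤ s ∧ Real.exp (a * s) * R = ‖y‖ ∧
      NormedSpace.exp (s • (a • (1 : EuclideanSpace ℝ (Fin 3) →L[ℝ] EuclideanSpace ℝ (Fin 3)) - B)) y₀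
        = y := by
  set A : EuclideanSpace ℝ (Fin 3) →L[ℝ] EuclideanSpace ℝ (Fin 3) :=
    a • (1 : EuclideanSpace ℝ (Fin 3) →L[ℝ] EuclideanSpace ℝ (Fin 3)) - B with hA
  have hypos : 0 < ‖y‖ := hR.trans_le hy
  have hq : 1 ≤ ‖y‖ / R := by rwa [le_div_iff₀ hR, one_mul]
  set s : ℝ := Real.log (‖y‖ / R) / a with hs
  have has : a * s = Real.log (‖y‖ / R) := by rw [hs]; field_simp
  have hexp : Real.exp (a * s) = ‖y‖ / R := by rw [has]; exact Real.exp_log (by positivity)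
  refine ⟨NormedSpace.exp ((-s) • A) y, s, ?_, ?_, ?_, ?_⟩
  · rw [norm_flow hB a y (-s), mul_neg, Real.exp_neg, hexp]
    field_simp
  · rw [hs]
    exact div_nonneg (Real.log_nonneg hq) ha.le
  · rw [hexp]
    field_simp
  · exact flow_flow_neg A y s

/-- For skew `B`, `exp(sB)` preserves norms. [folklore] -/
theorem norm_exp_smul_skew {B : EuclideanSpace ℝ (Fin 3) →L[ℝ] EuclideanSpace ℝ (Fin 3)}
    (hB : ∀ x, inner ℝ (B x) x = 0) (s : ℝ) (v : EuclideanSpace ℝ (Fin 3)) :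
    ‖NormedSpace.exp (s • B) v‖ = ‖v‖ := by
  obtain ⟨L, -, hL⟩ := rss_exists_rot hB s
  rw [← hL v]
  exact L.symm.norm_map v

/-- `exp(sB)` commutes with `B`. [folklore] -/
theorem exp_smul_apply_comm (B : EuclideanSpace ℝ (Fin 3) →L[ℝ] EuclideanSpace ℝ (Fin 3)) (s : ℝ)
    (v : EuclideanSpace ℝ (Fin 3)) :
    NormedSpace.exp (s • B) (B v) = B (NormedSpace.exp (s • B) v) := by
  have h : Commute B (NormedSpace.exp (s • B)) := ((Commute.refl B).smul_right s).exp_right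
  show (NormedSpace.exp (s • B) * B) v = (B * NormedSpace.exp (s • B)) v
  rw [h.eq]

/-! ## §2 The transport estimate along the spiral characteristics -/

/-- Unfolding the drift operator `A = a·1 − B`: `A z = az − Bz`. -/
theorem drift_apply (a : ℝ) (B : EuclideanSpace ℝ (Fin 3) →L[ℝ] EuclideanSpace ℝ (Fin 3))
    (z : EuclideanSpace ℝ (Fin 3)) :
    (a • (1 : EuclideanSpace ℝ (Fin 3) →L[ℝ] EuclideanSpace ℝ (Fin 3)) - B) z = a • z - B z := rfl

/-- **Spiral transport estimate (forcing form).**  Let `a > 0`, `B` skew, `W ∈ C¹(ℝ³; ℝ³)` with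
`‖W‖ ≤ m` on the sphere `‖y‖ = R` (`R > 0`), and suppose that on the shell `R ≤ ‖y‖ ≤ ρ` the transport
expression `G = DW·(ay − By) + aW + BW` obeys `‖G(y)‖ ≤ D/‖y‖² + C/‖y‖^{1+δ}` (`δ > 0`).  Then on that shell
`‖y‖ ‖W(y)‖ ≤ R m + D/(aR) + C/(aδR^δ)`.  Proof: along the characteristic `γ(s) = exp(s(a − B)) y₀`,
`|γ(s)| = e^{as}R`, the conjugated unknown `Z(s) = e^{as} exp(sB) W(γ(s))` has `Z' = e^{as} exp(sB) G(γ(s))`,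
so `‖Z'‖ = e^{as}‖G(γ(s))‖ ≤ (D/R²)e^{−as} + (C/R^{1+δ})e^{−aδs}`, which integrates (fencing lemma); the
homogeneous decay `e^{−as} = R/‖y‖` is the Type-I rate. [folklore] -/
theorem norm_mul_norm_le_of_transport {a : ℝ} (ha : 0 < a)
    {B : EuclideanSpace ℝ (Fin 3) →L[ℝ] EuclideanSpace ℝ (Fin 3)} (hB : ∀ x, inner ℝ (B x) x = 0)
    {W : EuclideanSpace ℝ (Fin 3) → EuclideanSpace ℝ (Fin 3)} (hW : Differentiable ℝ W)
    {R ρ D C δ m : ℝ} (hR : 0 < R) (hδ : 0 < δ) (hD : 0 ≤ D) (hC : 0 ≤ C)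
    (hm : ∀ y : EuclideanSpace ℝ (Fin 3), ‖y‖ = R → ‖W y‖ ≤ m)
    (hG : ∀ y : EuclideanSpace ℝ (Fin 3), R ≤ ‖y‖ → ‖y‖ ≤ ρ →
      ‖fderiv ℝ W y (a • y - B y) + (a • W y + B (W y))‖ ≤ D / ‖y‖ ^ 2 + C / ‖y‖ ^ (1 + δ))
    {y : EuclideanSpace ℝ (Fin 3)} (hy1 : R ≤ ‖y‖) (hy2 : ‖y‖ ≤ ρ) :
    ‖y‖ * ‖W y‖ ≤ R * m + D / (a * R) + C / (a * δ * R ^ δ) := by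
  obtain ⟨y₀, s₁, hy₀, hs₁, hexp, hflow⟩ := exists_flow_eq ha hB hR hy1
  set A : EuclideanSpace ℝ (Fin 3) →L[ℝ] EuclideanSpace ℝ (Fin 3) :=
    a • (1 : EuclideanSpace ℝ (Fin 3) →L[ℝ] EuclideanSpace ℝ (Fin 3)) - B with hA
  set γ : ℝ → EuclideanSpace ℝ (Fin 3) := fun s => NormedSpace.exp (s • A) y₀ with hγdef
  have hγ : ∀ s, HasDerivAt γ (a • γ s - B (γ s)) s := fun s => by
    have h := hasDerivAt_flow A y₀ s
    rwa [drift_apply] at h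
  have hγn : ∀ s, ‖γ s‖ = Real.exp (a * s) * R := fun s => by
    rw [← hy₀]; exact norm_flow hB a y₀ s
  have hγs₁ : γ s₁ = y := hflow
  have hm0 : 0 ≤ m := (norm_nonneg _).trans (hm y₀ hy₀)
  -- the transport expression
  set G : EuclideanSpace ℝ (Fin 3) → EuclideanSpace ℝ (Fin 3) :=
    fun z => fderiv ℝ W z (a • z - B z) + (a • W z + B (W z)) with hGdef
  -- the conjugated unknown and its derivative
  set Z : ℝ → EuclideanSpace ℝ (Fin 3) :=
    fun s => Real.exp (a * s) • NormedSpace.exp (s • B) (W (γ s)) with hZdef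
  set Z' : ℝ → EuclideanSpace ℝ (Fin 3) :=
    fun s => Real.exp (a * s) • NormedSpace.exp (s • B) (G (γ s)) with hZ'def
  have hZ : ∀ s, HasDerivAt Z (Z' s) s := by
    intro s
    have hu : HasDerivAt (fun s => W (γ s)) (fderiv ℝ W (γ s) (a • γ s - B (γ s))) s :=
      (hW (γ s)).hasFDerivAt.comp_hasDerivAt s (hγ s)
    have hc : HasDerivAt (fun s : ℝ => NormedSpace.exp (s • B)) (B * NormedSpace.exp (s • B)) s :=
      hasDerivAt_exp_smul_const' (𝕂 := ℝ) B s
    have hv := hc.clm_apply hu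
    have he : HasDerivAt (fun s : ℝ => Real.exp (a * s)) (Real.exp (a * s) * a) s := by
      have h := ((hasDerivAt_id s).const_mul a).exp
      simpa using h
    have hZ₁ := he.smul hv
    refine hZ₁.congr_deriv ?_
    rw [hZ'def]
    simp only [mul_apply_eq_comp, hGdef, map_add, map_smul, smul_add, map_sub, smul_sub,
      exp_smul_apply_comm B s (W (γ s)), mul_smul]
    abel
  -- the norm of the derivative
  have hZ'n : ∀ s, ‖Z' s‖ = Real.exp (a * s) * ‖G (γ s)‖ := fun s => by
    rw [hZ'def]
    simp only
    rw [norm_smul, Real.norm_of_nonneg (Real.exp_pos _).le, norm_exp_smul_skew hB]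
  -- the boundary function
  set Bnd : ℝ → ℝ := fun s => m + D / (a * R ^ 2) * (1 - Real.exp (-a * s)) +
    C / (a * δ * R ^ (1 + δ)) * (1 - Real.exp (-(a * δ) * s)) with hBnddef
  set Bnd' : ℝ → ℝ := fun s => D / R ^ 2 * Real.exp (-a * s) +
    C / R ^ (1 + δ) * Real.exp (-(a * δ) * s) with hBnd'def
  have hRδ : 0 < R ^ (1 + δ) := Real.rpow_pos_of_pos hR _
  have hBnd : ∀ s, HasDerivAt Bnd (Bnd' s) s := by
    intro s
    have h1 : HasDerivAt (fun s : ℝ => 1 - Real.exp (-a * s)) (-(Real.exp (-a * s) * -a)) s := by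
      have h := ((hasDerivAt_id s).const_mul (-a)).exp
      simp only [id, mul_one] at h
      exact h.const_sub 1
    have h2 : HasDerivAt (fun s : ℝ => 1 - Real.exp (-(a * δ) * s))
        (-(Real.exp (-(a * δ) * s) * -(a * δ))) s := by
      have h := ((hasDerivAt_id s).const_mul (-(a * δ))).exp
      simp only [id, mul_one] at h
      exact h.const_sub 1
    have h3 := ((h1.const_mul (D / (a * R ^ 2))).const_add m).add (h2.const_mul (C / (a * δ * R ^ (1 + δ))))
    refine h3.congr_deriv ?_
    rw [hBnd'def]
    simp only
    field_simp
  -- the bound on the derivative along `[0, s₁)`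
  have hbound : ∀ s ∈ Ico (0 : ℝ) s₁, ‖Z' s‖ ≤ Bnd' s := by
    intro s hs
    have hes : 1 ≤ Real.exp (a * s) := Real.one_le_exp (mul_nonneg ha.le hs.1)
    have hepos : 0 < Real.exp (a * s) := Real.exp_pos _
    have hγ1 : R ≤ ‖γ s‖ := by
      rw [hγn]; nlinarith
    have hγ2 : ‖γ s‖ ≤ ρ := by
      rw [hγn]
      have : Real.exp (a * s) ≤ Real.exp (a * s₁) :=
        Real.exp_le_exp.2 (mul_le_mul_of_nonneg_left hs.2.le ha.le)
      nlinarith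
    have hGs := hG (γ s) hγ1 hγ2
    rw [hZ'n s, hBnd'def]
    simp only
    rw [hγn] at hGs
    have e1 : Real.exp (a * s) * (D / (Real.exp (a * s) * R) ^ 2) = D / R ^ 2 * Real.exp (-a * s) := by
      rw [neg_mul, Real.exp_neg]
      field_simp
    have e2 : Real.exp (a * s) * (C / (Real.exp (a * s) * R) ^ (1 + δ)) =
        C / R ^ (1 + δ) * Real.exp (-(a * δ) * s) := by
      have hne2 : R ^ (1 + δ) ≠ 0 := hRδ.ne'
      have hδexp : Real.exp (a * s) ^ δ = Real.exp (a * δ * s) := by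
        rw [← Real.exp_mul]; ring_nf
      have hne1 : Real.exp (a * δ * s) ≠ 0 := (Real.exp_pos _).ne'
      rw [Real.mul_rpow hepos.le hR.le, Real.rpow_add hepos, Real.rpow_one, hδexp, neg_mul, Real.exp_neg]
      field_simp
    calc Real.exp (a * s) * ‖G (γ s)‖
        ≤ Real.exp (a * s) * (D / (Real.exp (a * s) * R) ^ 2 + C / (Real.exp (a * s) * R) ^ (1 + δ)) :=
          mul_le_mul_of_nonneg_left hGs hepos.le
      _ = D / R ^ 2 * Real.exp (-a * s) + C / R ^ (1 + δ) * Real.exp (-(a * δ) * s) := by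
          rw [mul_add, e1, e2]
  -- initial value
  have hZ0 : ‖Z 0‖ ≤ Bnd 0 := by
    rw [hZdef, hBnddef]
    simp only [mul_zero, Real.exp_zero, one_smul, sub_self, add_zero]
    rw [zero_smul, NormedSpace.exp_zero]
    change ‖W (γ 0)‖ ≤ m
    have hγ0 : γ 0 = y₀ := by
      change NormedSpace.exp ((0 : ℝ) • A) y₀ = y₀
      rw [zero_smul, NormedSpace.exp_zero]; rfl
    rw [hγ0]
    exact hm y₀ hy₀
  -- fencing
  have hcont : ContinuousOn Z (Icc 0 s₁) := fun s _ => (hZ s).continuousAt.continuousWithinAt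
  have hfence := image_norm_le_of_norm_deriv_right_le_deriv_boundary hcont
    (fun s _ => (hZ s).hasDerivWithinAt) hZ0 hBnd hbound (right_mem_Icc.2 hs₁)
  -- evaluate at `s₁`
  have hBnd1 : Bnd s₁ ≤ m + D / (a * R ^ 2) + C / (a * δ * R ^ (1 + δ)) := by
    rw [hBnddef]
    simp only
    have h1 : D / (a * R ^ 2) * (1 - Real.exp (-a * s₁)) ≤ D / (a * R ^ 2) :=
      mul_le_of_le_one_right (by positivity) (by linarith [Real.exp_pos (-a * s₁)])
    have h2 : C / (a * δ * R ^ (1 + δ)) * (1 - Real.exp (-(a * δ) * s₁)) ≤ C / (a * δ * R ^ (1 + δ)) :=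
      mul_le_of_le_one_right (by positivity) (by linarith [Real.exp_pos (-(a * δ) * s₁)])
    linarith
  have hZ1 : ‖Z s₁‖ = ‖y‖ / R * ‖W y‖ := by
    rw [hZdef]
    simp only
    rw [norm_smul, Real.norm_of_nonneg (Real.exp_pos _).le, norm_exp_smul_skew hB, hγs₁,
      show Real.exp (a * s₁) = ‖y‖ / R by rw [← hexp]; field_simp]
  have key : ‖y‖ / R * ‖W y‖ ≤ m + D / (a * R ^ 2) + C / (a * δ * R ^ (1 + δ)) := by
    rw [← hZ1]; exact hfence.trans hBnd1
  have hRδ' : R ^ (1 + δ) = R * R ^ δ := by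
    rw [Real.rpow_add hR, Real.rpow_one]
  rw [hRδ'] at key
  have hRδpos : 0 < R ^ δ := Real.rpow_pos_of_pos hR _
  have := mul_le_mul_of_nonneg_left key hR.le
  calc ‖y‖ * ‖W y‖ = R * (‖y‖ / R * ‖W y‖) := by field_simp
    _ ≤ R * (m + D / (a * R ^ 2) + C / (a * δ * (R * R ^ δ))) := this
    _ = R * m + D / (a * R) + C / (a * δ * R ^ δ) := by field_simp

end TypeIRate

end Summit.NavierStokesRegularity.NavierStokesRegularity.Theorems.CoriolisHead

end
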